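import Literature.IUT.LogThetaLattice.LogShellContainersLocalFieldIsos
import Literature.IUT.LogVolume.LocalFieldEmbeddings
import Mathlib.Analysis.Normed.Unbundled.SpectralNorm
import Mathlib.NumberTheory.Padics.PadicNumbers
import HarnessLib

/-!
# Every `ℚ_p`-algebra isomorphism — indeed every CONTINUOUS field isomorphism — of `p`-adic fields is ISOMETRIC:
# the hypothesis `hφ` of `LogShellContainer.homOfNormPreserving` discharged for algebraic / continuous field isomorphisms

Sequel (abc-iut cell, seat abc-iut-w5-d233 gen 4, self-named row «LOCALFIELD-ALGISO-ISOMETRIC»; PROOF-ONLY: theorems, no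
definitions) of abc-iut-w4-d005's `LogShellContainersLocalFieldIsos.lean` (p434940), answering abc-iut-L6-t21's second-read remark
(STATUS 2026-08-26T09:33:47Z): «for GENUINE local fields every continuous field isomorphism is automatically isometric (uniqueness
of the extension of `| |_p`), so a future consumer can discharge `hφ` from `k ≃+* k′` continuity; worth one lemma».

Classical input (uniqueness of the extended absolute value; J. Neukirch, *Algebraic Number Theory*, Ch. II Thm. (4.8); in Mathlib:
`spectralNorm_unique_field_norm_ext`, `NormedAlgebra.norm_eq_spectralNorm`) [cite: NeukirchANT1999, Ch. II (4.8)].  The tree already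
has: the two-field `ℚ_p`-algebra-homomorphism case for LOCALLY COMPACT source (`Literature.IUT.LogVolume.norm_map_algHom`, abc-iut
campaign S, `LocalFieldEmbeddings.lean`, via boundedness + `n`-th roots) and the one-field automorphism case (`norm_map_algEquiv`,
`norm_algEquiv_eq`, via `spectralNorm_eq_of_equiv`).  THIS FILE adds:

§1 (over ANY complete nontrivially normed ultrametric field `k`, source merely ALGEBRAIC — no local compactness):
* `norm_map_algHom_of_isAlgebraic` — for normed fields `K`, `K'` that are normed `k`-algebras with `K/k` algebraic, EVERY
  `k`-algebra homomorphism `φ : K →ₐ[k] K'` satisfies `‖φ x‖ = ‖x‖` (the absolute value `x ↦ ‖φ x‖` on `K` extends `‖·‖_k`, so it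
  is the spectral norm of `K/k`, which is `‖·‖_K`); `norm_map_algEquiv_symm_of_isAlgebraic`, `isometry_algHom_of_isAlgebraic`,
  `continuous_algHom_of_isAlgebraic`, `norm_le_one_iff_of_isAlgebraic` (`𝒪_K = φ⁻¹ 𝒪_{K'}`).
§2 (over `ℚ_p`, the continuity variant):
* `map_algebraMap_of_continuous` — a CONTINUOUS ring homomorphism between normed `ℚ_p`-algebras that are fields commutes with
  the structure maps (`ℚ` is dense in `ℚ_p`; both sides are continuous ring homomorphisms `ℚ_p → K'` agreeing on `ℚ`);
* `norm_map_ringHom_of_continuous` (source locally compact) / `norm_map_ringHom_of_continuous_of_isAlgebraic` (source algebraic),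
  `norm_map_ringEquiv_of_continuous`, `norm_map_ringEquiv_symm_of_continuous`, `norm_map_algEquiv_symm` — hence a continuous ring
  homomorphism / isomorphism of `p`-adic fields is isometric.
§3 (abc-iut-w4-d005's genuine log-shell containers `(k, 𝒪_k)`, [IUTchIII] Prop 1.2 (vi) p.32 / Prop 3.2 (i) p.93 / Prop 3.9 (ii)
  p.116 [claim key Mochizuki2012, status disputed (D-0012)]; [AbsTopIII] Prop 5.7 (i) p.137 [cite: MochizukiAbsTopIII2015, Prop. 5.7 (i) p. 137]):
* `exists_hom_of_algEquiv` / `exists_hom_of_ringEquiv_continuous` — every `ℚ_p`-algebra (resp. continuous ring) isomorphism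
  `e : K ≃ K'` of `p`-adic fields IS (the underlying map of) a morphism of genuine log-shell containers `(K, 𝒪_K) ⟶ (K', 𝒪_{K'})`
  (`homOfNormPreserving` with `hφ` DISCHARGED), lying in `isometricPoly K K'` (`exists_mem_isometricPoly_of_algEquiv` /
  `…_of_ringEquiv_continuous`); `image_closedBall_algEquiv` / `…_ringEquiv_continuous` (`e(𝒪_K) = 𝒪_{K'}`);
* `localLogVolume_image_algEquiv` / `…_ringEquiv_continuous` — **[IUTchIII] Prop 3.9 (ii) between two `p`-adic fields along ANY
  algebra / continuous field isomorphism**: `μ^log_{K'}(e(T)) = μ^log_K(T)` with ZERO isometry hypothesis (Haar transport BY NAME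
  through p434940's `localLogVolume_eq_of_normPreserving`).

HONEST SCOPE: classical valuation theory + container-level bookkeeping; which field isomorphisms the [IUTchII] prime-strip
categories induce at `v` is the kits' data BY NAME (they are `ℚ_{p_v}`-algebra isomorphisms of completions `K_v`, hence covered
by §3).  Nothing here takes a side on [IUTchIII] Cor. 3.12; typed ≠ endorsed; nothing asserts abc proved or refuted.
-/

noncomputable section

/-! ### §1. `k`-algebra homomorphisms out of ALGEBRAIC normed extensions are isometric (any complete ultrametric base) -/

namespace Literature.IUT.LogVolume

section AlgHom

variable {k : Type*} [NontriviallyNormedField k] [CompleteSpace k] [IsUltrametricDist k]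
  {K : Type*} [NormedField K] [NormedAlgebra k K] [Algebra.IsAlgebraic k K]
  {K' : Type*} [NormedField K'] [NormedAlgebra k K']

/-- **Uniqueness of the extended absolute value, two-field form, algebraic source**: every `k`-algebra homomorphism
`φ : K → K'` from an ALGEBRAIC normed field extension `K` of a complete nontrivially normed ultrametric field `k` to a normed field
extension `K'` of `k` is norm-preserving: `x ↦ ‖φ x‖` is an absolute value on `K` extending `‖·‖_k`, hence equals the spectral norm
of `K/k` (Mathlib `spectralNorm_unique_field_norm_ext`), which is `‖·‖_K` (`NormedAlgebra.norm_eq_spectralNorm`).  (The tree's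
`norm_map_algHom` is the case `k = ℚ_p`, `K` locally compact.) [cite: NeukirchANT1999, Ch. II (4.8)] -/
theorem norm_map_algHom_of_isAlgebraic (φ : K →ₐ[k] K') (x : K) : ‖φ x‖ = ‖x‖ := by
  have hinj : Function.Injective φ := (φ : K →+* K').injective
  let f : AbsoluteValue K ℝ :=
    { toFun := fun y => ‖φ y‖
      map_mul' := fun y z => by simp only [map_mul, norm_mul]
      nonneg' := fun y => norm_nonneg _
      eq_zero' := fun y => by
        constructor
        · intro hy
          exact hinj (by rw [map_zero]; exact norm_eq_zero.mp hy)
        · intro hy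
          rw [hy, map_zero, norm_zero]
      add_le' := fun y z => by
        simp only [map_add]
        exact norm_add_le _ _ }
  have hf : ∀ c : k, f (algebraMap k K c) = ‖c‖ := fun c => by
    change ‖φ (algebraMap k K c)‖ = ‖c‖
    rw [φ.commutes, norm_algebraMap']
  have h1 : f x = spectralNorm k K x := spectralNorm_unique_field_norm_ext hf x
  change f x = ‖x‖
  rw [h1, ← NormedAlgebra.norm_eq_spectralNorm k x]

/-- Isomorphism form of `norm_map_algHom_of_isAlgebraic`. [cite: NeukirchANT1999, Ch. II (4.8)] -/
theorem norm_map_algEquiv_of_isAlgebraic (e : K ≃ₐ[k] K') (x : K) : ‖e x‖ = ‖x‖ :=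
  norm_map_algHom_of_isAlgebraic (e : K →ₐ[k] K') x

/-- The inverse of a `k`-algebra isomorphism out of an algebraic normed extension is norm-preserving as well (no hypothesis on
`K'`: transport through `e`). [cite: NeukirchANT1999, Ch. II (4.8)] -/
theorem norm_map_algEquiv_symm_of_isAlgebraic (e : K ≃ₐ[k] K') (y : K') : ‖e.symm y‖ = ‖y‖ := by
  conv_rhs => rw [← e.apply_symm_apply y]
  rw [norm_map_algEquiv_of_isAlgebraic e]

/-- A `k`-algebra homomorphism out of an algebraic normed extension is an isometry … [cite: NeukirchANT1999, Ch. II (4.8)] -/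
theorem isometry_algHom_of_isAlgebraic (φ : K →ₐ[k] K') : Isometry φ :=
  AddMonoidHomClass.isometry_of_norm φ (norm_map_algHom_of_isAlgebraic φ)

/-- … hence continuous. [cite: NeukirchANT1999, Ch. II (4.8)] -/
theorem continuous_algHom_of_isAlgebraic (φ : K →ₐ[k] K') : Continuous φ :=
  (isometry_algHom_of_isAlgebraic φ).continuous

/-- … and carries integers to integers and non-integers to non-integers: `‖φ x‖ ≤ 1 ↔ ‖x‖ ≤ 1` (`𝒪_K = φ⁻¹(𝒪_{K'})`).
[cite: NeukirchANT1999, Ch. II (4.8)] -/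
theorem norm_le_one_iff_of_isAlgebraic (φ : K →ₐ[k] K') (x : K) : ‖φ x‖ ≤ 1 ↔ ‖x‖ ≤ 1 := by
  rw [norm_map_algHom_of_isAlgebraic]

end AlgHom

/-! ### §2. Over `ℚ_p`: continuous ring homomorphisms are `ℚ_p`-linear, hence isometric -/

section Padic

variable (p : ℕ) [Fact p.Prime]
  {K : Type*} [NormedField K] [NormedAlgebra ℚ_[p] K]
  {K' : Type*} [NormedField K'] [NormedAlgebra ℚ_[p] K']

include p

/-- **A continuous ring homomorphism between normed `ℚ_p`-algebras (fields) commutes with the structure maps**: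
`φ ∘ (ℚ_p → K)` and `ℚ_p → K'` are continuous ring homomorphisms `ℚ_p → K'` that agree on the dense subset `ℚ ⊆ ℚ_p`.
[cite: NeukirchANT1999, Ch. II (4.8)] -/
theorem map_algebraMap_of_continuous (φ : K →+* K') (hφ : Continuous φ) (c : ℚ_[p]) :
    φ (algebraMap ℚ_[p] K c) = algebraMap ℚ_[p] K' c := by
  have h1 : Continuous fun c : ℚ_[p] => φ (algebraMap ℚ_[p] K c) :=
    hφ.comp (continuous_algebraMap ℚ_[p] K)
  have h2 : Continuous fun c : ℚ_[p] => algebraMap ℚ_[p] K' c := continuous_algebraMap ℚ_[p] K'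
  have h3 : (fun c : ℚ_[p] => φ (algebraMap ℚ_[p] K c)) ∘ ((↑) : ℚ → ℚ_[p]) =
      (fun c : ℚ_[p] => algebraMap ℚ_[p] K' c) ∘ ((↑) : ℚ → ℚ_[p]) := by
    funext q
    simp only [Function.comp_apply, map_ratCast]
  exact congr_fun ((Padic.denseRange_ratCast p).equalizer h1 h2 h3) c

/-- **Every CONTINUOUS ring homomorphism from a locally compact normed extension `K/ℚ_p` (a `p`-adic field) to a normed field
extension `K'/ℚ_p` is norm-preserving** (abc-iut-L6-t21's remark: for genuine local fields the isometry hypothesis follows from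
continuity) — it is a `ℚ_p`-algebra homomorphism by `map_algebraMap_of_continuous`, so the tree's `norm_map_algHom` applies.
[cite: NeukirchANT1999, Ch. II (4.8)] -/
theorem norm_map_ringHom_of_continuous [ProperSpace K] (φ : K →+* K') (hφ : Continuous φ) (x : K) : ‖φ x‖ = ‖x‖ :=
  norm_map_algHom ({ φ with commutes' := map_algebraMap_of_continuous p φ hφ } : K →ₐ[ℚ_[p]] K') x

/-- The same with the source merely ALGEBRAIC over `ℚ_p` (§1). [cite: NeukirchANT1999, Ch. II (4.8)] -/
theorem norm_map_ringHom_of_continuous_of_isAlgebraic [Algebra.IsAlgebraic ℚ_[p] K] (φ : K →+* K') (hφ : Continuous φ)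
    (x : K) : ‖φ x‖ = ‖x‖ :=
  norm_map_algHom_of_isAlgebraic ({ φ with commutes' := map_algebraMap_of_continuous p φ hφ } : K →ₐ[ℚ_[p]] K') x

/-- A continuous ring ISOMORPHISM `e : K ≃+* K'` of `p`-adic fields (`K` locally compact) is norm-preserving …
[cite: NeukirchANT1999, Ch. II (4.8)] -/
theorem norm_map_ringEquiv_of_continuous [ProperSpace K] (e : K ≃+* K') (he : Continuous e) (x : K) : ‖e x‖ = ‖x‖ :=
  norm_map_ringHom_of_continuous p (e : K →+* K') he x

/-- … and so is its inverse. [cite: NeukirchANT1999, Ch. II (4.8)] -/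
theorem norm_map_ringEquiv_symm_of_continuous [ProperSpace K] (e : K ≃+* K') (he : Continuous e) (y : K') :
    ‖e.symm y‖ = ‖y‖ := by
  conv_rhs => rw [← e.apply_symm_apply y]
  rw [norm_map_ringEquiv_of_continuous p e he]

/-- Isomorphism form of the tree's `norm_map_algHom` (source locally compact). [cite: NeukirchANT1999, Ch. II (4.8)] -/
theorem norm_map_algEquiv_padic [ProperSpace K] (e : K ≃ₐ[ℚ_[p]] K') (x : K) : ‖e x‖ = ‖x‖ :=
  norm_map_algHom (e : K →ₐ[ℚ_[p]] K') x

/-- The inverse of a `ℚ_p`-algebra isomorphism out of a `p`-adic field is norm-preserving (companion of the tree's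
`norm_map_algHom`, no hypothesis on `K'`). [cite: NeukirchANT1999, Ch. II (4.8)] -/
theorem norm_map_algEquiv_symm [ProperSpace K] (e : K ≃ₐ[ℚ_[p]] K') (y : K') : ‖e.symm y‖ = ‖y‖ := by
  conv_rhs => rw [← e.apply_symm_apply y]
  rw [norm_map_algEquiv_padic p e]

end Padic

end Literature.IUT.LogVolume

/-! ### §3. Consequences for the genuine log-shell containers `(k, 𝒪_k)` of abc-iut-w4-d005 -/

namespace Literature.IUT.LogThetaLattice

namespace LogShellContainer

open CategoryTheory Set Metric
open Literature.IUT.LogVolume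

universe u

section Padic

variable (p : ℕ) [Fact p.Prime]
  (K K' : Type u) [NontriviallyNormedField K] [NormedAlgebra ℚ_[p] K] [ProperSpace K]
  [NontriviallyNormedField K'] [NormedAlgebra ℚ_[p] K']

include p

/-- **IUTchIII:Prop1.2(vi)** (kurims p.32) / [AbsTopIII] Prop 5.7 (i): a `ℚ_p`-algebra isomorphism `e : K ≃ K'` of `p`-adic fields
carries `𝒪_K` ONTO `𝒪_{K'}` — no isometry hypothesis. [claim: Mochizuki2012, status: disputed] -/
theorem image_closedBall_algEquiv (e : K ≃ₐ[ℚ_[p]] K') : e '' closedBall (0 : K) 1 = closedBall (0 : K') 1 := by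
  ext y
  simp only [mem_image, mem_closedBall, dist_zero_right]
  constructor
  · rintro ⟨x, hx, rfl⟩
    rwa [norm_map_algEquiv_padic p e]
  · intro hy
    exact ⟨e.symm y, by rwa [norm_map_algEquiv_symm p e], e.apply_symm_apply y⟩

/-- `𝒪_K` is carried onto `𝒪_{K'}` by every CONTINUOUS field isomorphism as well ([AbsTopIII] Prop 5.7 (i)).
[cite: MochizukiAbsTopIII2015, Prop. 5.7 (i) p. 137] -/
theorem image_closedBall_ringEquiv_continuous (e : K ≃+* K') (he : Continuous e) :
    e '' closedBall (0 : K) 1 = closedBall (0 : K') 1 := by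
  ext y
  simp only [mem_image, mem_closedBall, dist_zero_right]
  constructor
  · rintro ⟨x, hx, rfl⟩
    rwa [norm_map_ringEquiv_of_continuous p e he]
  · intro hy
    exact ⟨e.symm y, by rwa [norm_map_ringEquiv_symm_of_continuous p e he], e.apply_symm_apply y⟩

variable [IsUltrametricDist K] [IsUltrametricDist K'] [ProperSpace K']

/-- **Every `ℚ_p`-algebra isomorphism of `p`-adic fields IS a morphism of genuine log-shell containers
`(K, 𝒪_K) ⟶ (K', 𝒪_{K'})`** — abc-iut-w4-d005's `homOfNormPreserving` with its hypothesis `hφ` DISCHARGED by the tree's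
`norm_map_algHom` (the bicontinuous additive isomorphism is `e` itself, continuous both ways as an isometry).
[claim: Mochizuki2012, status: disputed] -/
theorem exists_hom_of_algEquiv (e : K ≃ₐ[ℚ_[p]] K') :
    ∃ f : ofLocalField K ⟶ ofLocalField K', (⇑e : K → K') = ⇑f.iso :=
  ⟨homOfNormPreserving K K'
      { e.toAddEquiv with
        continuous_toFun := (AddMonoidHomClass.isometry_of_norm e (norm_map_algEquiv_padic p e)).continuous
        continuous_invFun := (AddMonoidHomClass.isometry_of_norm e.symm (norm_map_algEquiv_symm p e)).continuous }
      (norm_map_algEquiv_padic p e),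
    rfl⟩

/-- The isomorphism of containers induced by a `ℚ_p`-algebra isomorphism lies in the poly-isomorphism `isometricPoly K K'` of
p434940 ([IUTchIII] Prop 3.2 (i) read at the containers). [claim: Mochizuki2012, status: disputed] -/
theorem exists_mem_isometricPoly_of_algEquiv (e : K ≃ₐ[ℚ_[p]] K') :
    ∃ f ∈ isometricPoly K K', (⇑e : K → K') = (forget.mapIso f).hom := by
  let φ : K ≃ₜ+ K' :=
    { e.toAddEquiv with
      continuous_toFun := (AddMonoidHomClass.isometry_of_norm e (norm_map_algEquiv_padic p e)).continuous
      continuous_invFun := (AddMonoidHomClass.isometry_of_norm e.symm (norm_map_algEquiv_symm p e)).continuous }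
  exact ⟨isoOfHom (homOfNormPreserving K K' φ (norm_map_algEquiv_padic p e)),
    isoOfHom_homOfNormPreserving_mem K K' φ (norm_map_algEquiv_padic p e), rfl⟩

/-- Hence `isometricPoly K K'` is NONEMPTY as soon as `K` and `K'` are `ℚ_p`-algebra isomorphic (non-vacuity from field data,
no isometry to be supplied). [claim: Mochizuki2012, status: disputed] -/
theorem isometricPoly_nonempty_of_algEquiv (e : K ≃ₐ[ℚ_[p]] K') : (isometricPoly K K').Nonempty := by
  obtain ⟨f, hf, -⟩ := exists_mem_isometricPoly_of_algEquiv p K K' e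
  exact ⟨f, hf⟩

/-- **IUTchIII:Prop3.9(ii)** (kurims p.116) **between two `p`-adic fields along ANY `ℚ_p`-algebra isomorphism, ZERO isometry
hypothesis**: the normalised log-volume is transported, `μ^log_{K'}(e(T)) = μ^log_K(T)` (p434940's
`localLogVolume_eq_of_normPreserving` with `hφ` discharged). [claim: Mochizuki2012, status: disputed] -/
theorem localLogVolume_image_algEquiv (e : K ≃ₐ[ℚ_[p]] K') (T : Set K) :
    (ofLocalField K').Λ.logVolume (e '' T) = (ofLocalField K).Λ.logVolume T :=
  localLogVolume_eq_of_normPreserving K K'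
    { e.toAddEquiv with
      continuous_toFun := (AddMonoidHomClass.isometry_of_norm e (norm_map_algEquiv_padic p e)).continuous
      continuous_invFun := (AddMonoidHomClass.isometry_of_norm e.symm (norm_map_algEquiv_symm p e)).continuous }
    (norm_map_algEquiv_padic p e) T

/-- **abc-iut-L6-t21's remark, kernel form**: every CONTINUOUS ring isomorphism `e : K ≃+* K'` of `p`-adic fields IS a morphism
of genuine log-shell containers — `hφ` of `homOfNormPreserving` follows from continuity. [claim: Mochizuki2012, status: disputed] -/
theorem exists_hom_of_ringEquiv_continuous (e : K ≃+* K') (he : Continuous e) :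
    ∃ f : ofLocalField K ⟶ ofLocalField K', (⇑e : K → K') = ⇑f.iso :=
  ⟨homOfNormPreserving K K'
      { e.toAddEquiv with
        continuous_toFun := he
        continuous_invFun :=
          (AddMonoidHomClass.isometry_of_norm e.symm (norm_map_ringEquiv_symm_of_continuous p e he)).continuous }
      (norm_map_ringEquiv_of_continuous p e he),
    rfl⟩

/-- … and lies in `isometricPoly K K'`. [claim: Mochizuki2012, status: disputed] -/
theorem exists_mem_isometricPoly_of_ringEquiv_continuous (e : K ≃+* K') (he : Continuous e) :
    ∃ f ∈ isometricPoly K K', (⇑e : K → K') = (forget.mapIso f).hom := by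
  let φ : K ≃ₜ+ K' :=
    { e.toAddEquiv with
      continuous_toFun := he
      continuous_invFun :=
        (AddMonoidHomClass.isometry_of_norm e.symm (norm_map_ringEquiv_symm_of_continuous p e he)).continuous }
  exact ⟨isoOfHom (homOfNormPreserving K K' φ (norm_map_ringEquiv_of_continuous p e he)),
    isoOfHom_homOfNormPreserving_mem K K' φ (norm_map_ringEquiv_of_continuous p e he), rfl⟩

/-- **IUTchIII:Prop3.9(ii)** along any CONTINUOUS field isomorphism of `p`-adic fields: `μ^log_{K'}(e(T)) = μ^log_K(T)`.
[claim: Mochizuki2012, status: disputed] -/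
theorem localLogVolume_image_ringEquiv_continuous (e : K ≃+* K') (he : Continuous e) (T : Set K) :
    (ofLocalField K').Λ.logVolume (e '' T) = (ofLocalField K).Λ.logVolume T :=
  localLogVolume_eq_of_normPreserving K K'
    { e.toAddEquiv with
      continuous_toFun := he
      continuous_invFun :=
        (AddMonoidHomClass.isometry_of_norm e.symm (norm_map_ringEquiv_symm_of_continuous p e he)).continuous }
    (norm_map_ringEquiv_of_continuous p e he) T

end Padic

end LogShellContainer

end Literature.IUT.LogThetaLattice

end
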